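import Summits.AtomisticToContinuum.FouriersLaw.Theorems.PhononMeanFreePathIncoherentChannelLightConeHelper2

/-!
# Light-cone stub: reduction of `r_N`, `P_N` to ONE propagation functional (`lightCone_reduction`)

Helper for the registered stub `stub_lightCone` of line `two-horizons-forecast-loss`
(crux `PhononMeanFreePath.IncoherentChannel`, stmt-AtomisticToContinuum-11811), registered sub-goal
`lightCone_reduction`.

`P = pinnedChain ω₂ lam β γ` (`ω₂ > 0`, `lam, β, γ ≥ 0`), `T > 0`, `μ₀ = P.gibbsMeasure (N+1) T`,
`ν = gaussianReal 0 T`, `v = fcast … N t = K_t p_N` (mean forecast of the far momentum). RESAMPLING: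
for `x = (z, s)`, `z̃ = (z.1, update z.2 0 s)` is `z` with the initial momentum `p₀` replaced by the
fresh Gaussian `s`; under `μ₀ ⊗ ν` the pair `(p₀, z̃)` has law `ν ⊗ μ₀` (helper 1). Hence every
functional of `z̃` is orthogonal to `p₀` and to `p₀² - T`, and

* `r_N(t) = pairCorr = ∫ p₀ (v(z) - v(z̃)) d(μ₀ ⊗ ν)`             (`lightCone_pairCorr_eq`),
* `P_N(t) = commonPast = ∫ p₀² (v(z)² - v(z̃)²) d(μ₀ ⊗ ν)`          (`lightCone_commonPast_eq`),

so with the PROPAGATION FUNCTIONAL `D_N(t) = ∫ (v(z) - v(z̃))² d(μ₀ ⊗ ν)` (how much the far forecast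
feels the initial momentum `p₀`), Cauchy–Schwarz and the Gaussian/kernel moment bounds of helper 2 give

* `r_N(t)² ≤ T · D_N(t)` and `|P_N(t)| ≤ K · √(D_N(t))`, `K = K(T) = √(2∫s⁸dν + 2∫s⁴dν)` uniform in
  `N` and `t` (`lightCone_reduction`).

The light-cone stub is thereby reduced to the finite-speed-of-propagation estimate
`N^{1+η} sup_{t ≤ N^η} D_N(t) → 0`.
-/

noncomputable section

namespace Summit.AtomisticToContinuum.FouriersLaw.Theorems.PhononMeanFreePath

open MeasureTheory ProbabilityTheory Set Filter Topology
open scoped NNReal ENNReal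
open Literature.MathematicalPhysics.KineticTheory.HeatConduction
open Summit.AtomisticToContinuum.FouriersLaw.Theorems.IncoherentChannel.Negative.GibbsStein (gibbs_sq_momentum)

/-! ### Elementary integral inequalities -/

/-- `f g ∈ L¹` when `f², g² ∈ L¹` (`|fg| ≤ (f² + g²)/2`). -/
theorem lightCone_integrable_mul_of_sq {α : Type*} [MeasurableSpace α] {μ : Measure α} {f g : α → ℝ}
    (hf : AEStronglyMeasurable f μ) (hg : AEStronglyMeasurable g μ)
    (hf2 : Integrable (fun x => f x ^ 2) μ) (hg2 : Integrable (fun x => g x ^ 2) μ) :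
    Integrable (fun x => f x * g x) μ := by
  refine ((hf2.add hg2).div_const 2).mono' (hf.mul hg) (Eventually.of_forall fun x => ?_)
  rw [Real.norm_eq_abs, abs_mul]
  change |f x| * |g x| ≤ (f x ^ 2 + g x ^ 2) / 2
  nlinarith [sq_nonneg (|f x| - |g x|), sq_abs (f x), sq_abs (g x)]

/-- **Cauchy–Schwarz** for real functions: `(∫ f g)² ≤ (∫ f²)(∫ g²)` (`f², g² ∈ L¹`). -/
theorem lightCone_integral_mul_sq_le {α : Type*} [MeasurableSpace α] {μ : Measure α} {f g : α → ℝ}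
    (hf : AEStronglyMeasurable f μ) (hg : AEStronglyMeasurable g μ)
    (hf2 : Integrable (fun x => f x ^ 2) μ) (hg2 : Integrable (fun x => g x ^ 2) μ) :
    (∫ x, f x * g x ∂μ) ^ 2 ≤ (∫ x, f x ^ 2 ∂μ) * ∫ x, g x ^ 2 ∂μ := by
  have hfg : Integrable (fun x => f x * g x) μ := lightCone_integrable_mul_of_sq hf hg hf2 hg2
  have hquad : ∀ r : ℝ, 0 ≤ (∫ x, f x ^ 2 ∂μ) * (r * r) + (2 * ∫ x, f x * g x ∂μ) * r + ∫ x, g x ^ 2 ∂μ := by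
    intro r
    have h0 : 0 ≤ ∫ x, (r * f x + g x) ^ 2 ∂μ := integral_nonneg fun x => sq_nonneg _
    have e : (fun x => (r * f x + g x) ^ 2) = fun x => (r ^ 2 * f x ^ 2 + 2 * r * (f x * g x)) + g x ^ 2 := by
      funext x; ring
    have h1 : Integrable (fun x => r ^ 2 * f x ^ 2 + 2 * r * (f x * g x)) μ :=
      (hf2.const_mul _).add (hfg.const_mul _)
    have h2 : Integrable (fun x => r ^ 2 * f x ^ 2) μ := hf2.const_mul _
    have h3 : Integrable (fun x => 2 * r * (f x * g x)) μ := hfg.const_mul _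
    rw [e, integral_add h1 hg2, integral_add h2 h3, integral_const_mul, integral_const_mul] at h0
    nlinarith [h0]
  have hd := discrim_le_zero hquad
  rw [discrim] at hd
  nlinarith [hd]

/-- `|a| ≤ K √D` from `a² ≤ K² D` (`K ≥ 0`). -/
theorem lightCone_abs_le_of_sq_le {a K D : ℝ} (hK : 0 ≤ K) (h : a ^ 2 ≤ K ^ 2 * D) :
    |a| ≤ K * Real.sqrt D := by
  rw [← Real.sqrt_sq_eq_abs, ← Real.sqrt_sq hK, ← Real.sqrt_mul (sq_nonneg K)]
  exact Real.sqrt_le_sqrt h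

/-- `(a²(b+c))² ≤ 2a⁸ + b⁴ + c⁴` (twice `2xy ≤ x² + y²`). -/
theorem lightCone_sq_mul_add_sq_le (a b c : ℝ) : (a ^ 2 * (b + c)) ^ 2 ≤ 2 * a ^ 8 + b ^ 4 + c ^ 4 := by
  have ha4 : 0 ≤ a ^ 4 := by positivity
  have h1 : (b + c) ^ 2 ≤ 2 * (b ^ 2 + c ^ 2) := by nlinarith [sq_nonneg (b - c)]
  have h2 : 2 * a ^ 4 * b ^ 2 ≤ a ^ 8 + b ^ 4 := by nlinarith [sq_nonneg (a ^ 4 - b ^ 2)]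
  have h3 : 2 * a ^ 4 * c ^ 2 ≤ a ^ 8 + c ^ 4 := by nlinarith [sq_nonneg (a ^ 4 - c ^ 2)]
  calc (a ^ 2 * (b + c)) ^ 2 = a ^ 4 * (b + c) ^ 2 := by ring
    _ ≤ a ^ 4 * (2 * (b ^ 2 + c ^ 2)) := mul_le_mul_of_nonneg_left h1 ha4
    _ = 2 * a ^ 4 * b ^ 2 + 2 * a ^ 4 * c ^ 2 := by ring
    _ ≤ 2 * a ^ 8 + b ^ 4 + c ^ 4 := by linarith

/-! ### The resampling identities -/

section Resampling

variable {ω₂ lam β γ T : ℝ} (hω : 0 < ω₂) (hl : 0 ≤ lam) (hβ : 0 ≤ β) (hT : 0 < T) (N : ℕ)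
include hω hl hβ hT

/-- Integrability transfer to the resampled state: `F ∈ L¹(μ₀) ⇒ F(z̃) ∈ L¹(μ₀ ⊗ ν)`. -/
theorem lightCone_integrable_comp_resample {F : PhaseSpace (N + 1) → ℝ} (hFm : AEStronglyMeasurable F
      ((pinnedChain ω₂ lam β γ).gibbsMeasure (N + 1) T))
    (hF : Integrable F ((pinnedChain ω₂ lam β γ).gibbsMeasure (N + 1) T)) :
    Integrable (fun x : PhaseSpace (N + 1) × ℝ => F ((x.1.1, Function.update x.1.2 0 x.2) : PhaseSpace (N + 1)))
      (((pinnedChain ω₂ lam β γ).gibbsMeasure (N + 1) T).prod (gaussianReal 0 T.toNNReal)) := by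
  have hmap := lightCone_gibbs_map_resample (γ := γ) hω hl hβ hT (0 : Fin (N + 1)) (n := N)
  rw [← hmap] at hFm hF
  exact (integrable_map_measure hFm (lightCone_measurable_resample 0).aemeasurable).1 hF

/-- Integrals of functionals of the resampled state: `∫ F(z̃) d(μ₀ ⊗ ν) = ∫ F dμ₀`. -/
theorem lightCone_integral_comp_resample {F : PhaseSpace (N + 1) → ℝ} (hFm : Measurable F) :
    ∫ x : PhaseSpace (N + 1) × ℝ, F ((x.1.1, Function.update x.1.2 0 x.2) : PhaseSpace (N + 1))
        ∂(((pinnedChain ω₂ lam β γ).gibbsMeasure (N + 1) T).prod (gaussianReal 0 T.toNNReal)) =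
      ∫ z, F z ∂((pinnedChain ω₂ lam β γ).gibbsMeasure (N + 1) T) := by
  have hmap := lightCone_gibbs_map_resample (γ := γ) hω hl hβ hT (0 : Fin (N + 1)) (n := N)
  have hFm' : AEStronglyMeasurable F ((((pinnedChain ω₂ lam β γ).gibbsMeasure (N + 1) T).prod
      (gaussianReal 0 T.toNNReal)).map
        fun x : PhaseSpace (N + 1) × ℝ => ((x.1.1, Function.update x.1.2 0 x.2) : PhaseSpace (N + 1))) := by
    rw [hmap]; exact hFm.aestronglyMeasurable
  rw [← integral_map (lightCone_measurable_resample 0).aemeasurable hFm', hmap]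

/-- **Orthogonality to the resampled state**: for measurable `h`, `F`,
`∫ h(p₀) F(z̃) d(μ₀ ⊗ ν) = (∫ h dν)(∫ F dμ₀)` — the pair `(p₀, z̃)` has law `ν ⊗ μ₀`. -/
theorem lightCone_integral_momentum_mul_comp_resample {h : ℝ → ℝ} {F : PhaseSpace (N + 1) → ℝ}
    (hhm : Measurable h) (hFm : Measurable F) :
    ∫ x : PhaseSpace (N + 1) × ℝ, h (x.1.2 0) * F ((x.1.1, Function.update x.1.2 0 x.2) : PhaseSpace (N + 1))
        ∂(((pinnedChain ω₂ lam β γ).gibbsMeasure (N + 1) T).prod (gaussianReal 0 T.toNNReal)) =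
      (∫ s, h s ∂(gaussianReal 0 T.toNNReal)) * ∫ z, F z ∂((pinnedChain ω₂ lam β γ).gibbsMeasure (N + 1) T) := by
  haveI : IsProbabilityMeasure ((pinnedChain ω₂ lam β γ).gibbsMeasure (N + 1) T) :=
    pinnedChain_isProbabilityMeasure_gibbsMeasure hω hl hβ γ (N + 1) hT
  have hmap := lightCone_gibbs_map_momentum_resample (γ := γ) hω hl hβ hT (0 : Fin (N + 1)) (n := N)
  have hQ : Measurable fun x : PhaseSpace (N + 1) × ℝ =>
      (x.1.2 0, ((x.1.1, Function.update x.1.2 0 x.2) : PhaseSpace (N + 1))) :=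
    ((measurable_pi_apply 0).comp (measurable_snd.comp measurable_fst)).prodMk (lightCone_measurable_resample 0)
  have hG : AEStronglyMeasurable (fun y : ℝ × PhaseSpace (N + 1) => h y.1 * F y.2)
      ((((pinnedChain ω₂ lam β γ).gibbsMeasure (N + 1) T).prod (gaussianReal 0 T.toNNReal)).map
        fun x : PhaseSpace (N + 1) × ℝ => (x.1.2 0, ((x.1.1, Function.update x.1.2 0 x.2) : PhaseSpace (N + 1)))) := by
    rw [hmap]
    exact ((hhm.comp measurable_fst).mul (hFm.comp measurable_snd)).aestronglyMeasurable
  have h1 := integral_map hQ.aemeasurable hG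
  rw [hmap, integral_prod_mul h F] at h1
  exact h1.symm

variable (hγ : 0 ≤ γ) (t : ℝ)
include hγ

/-- `r_N(t) = ∫ p₀ (v(z) - v(z̃)) d(μ₀ ⊗ ν)`: the resampled forecast is orthogonal to `p₀`
(`∫ s dν = 0`). -/
theorem lightCone_pairCorr_eq :
    pairCorr ω₂ lam β γ T N t =
      ∫ x : PhaseSpace (N + 1) × ℝ, x.1.2 0 * (fcast ω₂ lam β γ T N t x.1 -
        fcast ω₂ lam β γ T N t ((x.1.1, Function.update x.1.2 0 x.2) : PhaseSpace (N + 1)))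
        ∂(((pinnedChain ω₂ lam β γ).gibbsMeasure (N + 1) T).prod (gaussianReal 0 T.toNNReal)) := by
  set v := fcast ω₂ lam β γ T N t with hv
  set μ₀ := (pinnedChain ω₂ lam β γ).gibbsMeasure (N + 1) T with hμ₀
  set ν := gaussianReal 0 T.toNNReal with hν
  haveI : IsProbabilityMeasure μ₀ := pinnedChain_isProbabilityMeasure_gibbsMeasure hω hl hβ γ (N + 1) hT
  obtain ⟨hvm, hv2, -, -, -⟩ := lightCone_fcast_moments ω₂ lam β γ hω hl hβ hγ T hT N t
  have hp2 : Integrable (fun z : PhaseSpace (N + 1) => z.2 0 ^ 2) μ₀ := lightCone_integrable_momentum_pow hω hl hβ hT 0 2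
  have hpm : Measurable fun z : PhaseSpace (N + 1) => z.2 0 := (measurable_pi_apply 0).comp measurable_snd
  have hI0 : Integrable (fun z : PhaseSpace (N + 1) => z.2 0 * v z) μ₀ :=
    lightCone_integrable_mul_of_sq hpm.aestronglyMeasurable hvm.aestronglyMeasurable hp2 hv2
  have hI1 : Integrable (fun x : PhaseSpace (N + 1) × ℝ => x.1.2 0 * v x.1) (μ₀.prod ν) := hI0.comp_fst ν
  have hI2 : Integrable (fun x : PhaseSpace (N + 1) × ℝ =>
      x.1.2 0 * v ((x.1.1, Function.update x.1.2 0 x.2) : PhaseSpace (N + 1))) (μ₀.prod ν) :=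
    lightCone_integrable_mul_of_sq (hpm.comp measurable_fst).aestronglyMeasurable
      (hvm.comp (lightCone_measurable_resample 0)).aestronglyMeasurable (hp2.comp_fst ν)
      (lightCone_integrable_comp_resample hω hl hβ hT N (F := fun z => v z ^ 2)
        (hvm.pow_const 2).aestronglyMeasurable hv2)
  have h0 : ∫ x : PhaseSpace (N + 1) × ℝ, x.1.2 0 * v ((x.1.1, Function.update x.1.2 0 x.2) : PhaseSpace (N + 1))
      ∂(μ₀.prod ν) = 0 := by
    have := lightCone_integral_momentum_mul_comp_resample (γ := γ) hω hl hβ hT N (h := fun s => s) (F := v)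
      measurable_id hvm
    rw [this, integral_id_gaussianReal, zero_mul]
  simp_rw [mul_sub]
  rw [integral_sub hI1 hI2, h0, sub_zero, integral_fun_fst (fun z : PhaseSpace (N + 1) => z.2 0 * v z),
    probReal_univ, one_smul]
  rfl

/-- `P_N(t) = ∫ p₀² (v(z)² - v(z̃)²) d(μ₀ ⊗ ν)`: `∫ p₀² v(z̃)² = (∫ s² dν)(∫ v² dμ₀) = T ∫ v² dμ₀`. -/
theorem lightCone_commonPast_eq :
    commonPast ω₂ lam β γ T N t =
      ∫ x : PhaseSpace (N + 1) × ℝ, x.1.2 0 ^ 2 * (fcast ω₂ lam β γ T N t x.1 ^ 2 -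
        fcast ω₂ lam β γ T N t ((x.1.1, Function.update x.1.2 0 x.2) : PhaseSpace (N + 1)) ^ 2)
        ∂(((pinnedChain ω₂ lam β γ).gibbsMeasure (N + 1) T).prod (gaussianReal 0 T.toNNReal)) := by
  set v := fcast ω₂ lam β γ T N t with hv
  set μ₀ := (pinnedChain ω₂ lam β γ).gibbsMeasure (N + 1) T with hμ₀
  set ν := gaussianReal 0 T.toNNReal with hν
  haveI : IsProbabilityMeasure μ₀ := pinnedChain_isProbabilityMeasure_gibbsMeasure hω hl hβ γ (N + 1) hT
  obtain ⟨hvm, -, hv4, -, -⟩ := lightCone_fcast_moments ω₂ lam β γ hω hl hβ hγ T hT N t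
  have hp4 : Integrable (fun z : PhaseSpace (N + 1) => z.2 0 ^ 4) μ₀ := lightCone_integrable_momentum_pow hω hl hβ hT 0 4
  have hpm : Measurable fun z : PhaseSpace (N + 1) => z.2 0 := (measurable_pi_apply 0).comp measurable_snd
  have hp4' : Integrable (fun z : PhaseSpace (N + 1) => (z.2 0 ^ 2) ^ 2) μ₀ :=
    hp4.congr (Eventually.of_forall fun z => by ring)
  have hv4' : Integrable (fun z : PhaseSpace (N + 1) => (v z ^ 2) ^ 2) μ₀ :=
    hv4.congr (Eventually.of_forall fun z => by ring)
  have hI0 : Integrable (fun z : PhaseSpace (N + 1) => z.2 0 ^ 2 * v z ^ 2) μ₀ :=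
    lightCone_integrable_mul_of_sq (hpm.pow_const 2).aestronglyMeasurable (hvm.pow_const 2).aestronglyMeasurable
      hp4' hv4'
  have hI1 : Integrable (fun x : PhaseSpace (N + 1) × ℝ => x.1.2 0 ^ 2 * v x.1 ^ 2) (μ₀.prod ν) := hI0.comp_fst ν
  have hI2 : Integrable (fun x : PhaseSpace (N + 1) × ℝ =>
      x.1.2 0 ^ 2 * v ((x.1.1, Function.update x.1.2 0 x.2) : PhaseSpace (N + 1)) ^ 2) (μ₀.prod ν) :=
    lightCone_integrable_mul_of_sq ((hpm.comp measurable_fst).pow_const 2).aestronglyMeasurable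
      ((hvm.comp (lightCone_measurable_resample 0)).pow_const 2).aestronglyMeasurable (hp4'.comp_fst ν)
      (lightCone_integrable_comp_resample hω hl hβ hT N (F := fun z => (v z ^ 2) ^ 2)
        ((hvm.pow_const 2).pow_const 2).aestronglyMeasurable hv4')
  have hT2 : ∫ s, s ^ 2 ∂ν = T := by
    rw [hν, ← lightCone_integral_momentum_pow hω hl hβ hT (0 : Fin (N + 1)) 2 (γ := γ)]
    exact gibbs_sq_momentum hω hl hβ hT 0
  have h0 : ∫ x : PhaseSpace (N + 1) × ℝ, x.1.2 0 ^ 2 *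
      v ((x.1.1, Function.update x.1.2 0 x.2) : PhaseSpace (N + 1)) ^ 2 ∂(μ₀.prod ν) = T * ∫ z, v z ^ 2 ∂μ₀ := by
    have := lightCone_integral_momentum_mul_comp_resample (γ := γ) hω hl hβ hT N (h := fun s => s ^ 2)
      (F := fun z => v z ^ 2) (measurable_id.pow_const 2) (hvm.pow_const 2)
    rw [this, hT2]
  simp_rw [mul_sub]
  rw [integral_sub hI1 hI2, h0, integral_fun_fst (fun z : PhaseSpace (N + 1) => z.2 0 ^ 2 * v z ^ 2),
    probReal_univ, one_smul, commonPast, gibbs_sq_momentum hω hl hβ hT 0]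

end Resampling

/-! ### The reduction -/

section Reduction

variable {ω₂ lam β γ T : ℝ} (hω : 0 < ω₂) (hl : 0 ≤ lam) (hβ : 0 ≤ β) (hT : 0 < T) (N : ℕ)
include hω hl hβ hT

/-- The two Cauchy–Schwarz bounds for an abstract measurable `v` with `∫ v⁴ dμ₀ ≤ M₄ = ∫ s⁴ dν`:
`(∫ p₀ (v - ṽ))² ≤ T·D` and `(∫ p₀²(v² - ṽ²))² ≤ (2M₈ + 2M₄)·D`, `D = ∫ (v - ṽ)²`. -/
theorem lightCone_reduction_aux {v : PhaseSpace (N + 1) → ℝ} (hvm : Measurable v)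
    (hv2 : Integrable (fun z => v z ^ 2) ((pinnedChain ω₂ lam β γ).gibbsMeasure (N + 1) T))
    (hv4 : Integrable (fun z => v z ^ 4) ((pinnedChain ω₂ lam β γ).gibbsMeasure (N + 1) T))
    (hv4le : ∫ z, v z ^ 4 ∂((pinnedChain ω₂ lam β γ).gibbsMeasure (N + 1) T) ≤ ∫ s, s ^ 4 ∂(gaussianReal 0 T.toNNReal)) :
    (∫ x : PhaseSpace (N + 1) × ℝ, x.1.2 0 * (v x.1 - v ((x.1.1, Function.update x.1.2 0 x.2) : PhaseSpace (N + 1)))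
        ∂(((pinnedChain ω₂ lam β γ).gibbsMeasure (N + 1) T).prod (gaussianReal 0 T.toNNReal))) ^ 2 ≤
      T * ∫ x : PhaseSpace (N + 1) × ℝ, (v x.1 - v ((x.1.1, Function.update x.1.2 0 x.2) : PhaseSpace (N + 1))) ^ 2
        ∂(((pinnedChain ω₂ lam β γ).gibbsMeasure (N + 1) T).prod (gaussianReal 0 T.toNNReal)) ∧
    (∫ x : PhaseSpace (N + 1) × ℝ, x.1.2 0 ^ 2 * (v x.1 ^ 2 - v ((x.1.1, Function.update x.1.2 0 x.2) :
        PhaseSpace (N + 1)) ^ 2) ∂(((pinnedChain ω₂ lam β γ).gibbsMeasure (N + 1) T).prod (gaussianReal 0 T.toNNReal))) ^ 2 ≤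
      (2 * ∫ s, s ^ 8 ∂(gaussianReal 0 T.toNNReal) + 2 * ∫ s, s ^ 4 ∂(gaussianReal 0 T.toNNReal)) *
        ∫ x : PhaseSpace (N + 1) × ℝ, (v x.1 - v ((x.1.1, Function.update x.1.2 0 x.2) : PhaseSpace (N + 1))) ^ 2
        ∂(((pinnedChain ω₂ lam β γ).gibbsMeasure (N + 1) T).prod (gaussianReal 0 T.toNNReal)) := by
  set μ₀ := (pinnedChain ω₂ lam β γ).gibbsMeasure (N + 1) T with hμ₀
  set ν := gaussianReal 0 T.toNNReal with hν
  set M4 : ℝ := ∫ s, s ^ 4 ∂ν with hM4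
  set M8 : ℝ := ∫ s, s ^ 8 ∂ν with hM8
  haveI : IsProbabilityMeasure μ₀ := pinnedChain_isProbabilityMeasure_gibbsMeasure hω hl hβ γ (N + 1) hT
  set R : PhaseSpace (N + 1) × ℝ → PhaseSpace (N + 1) := fun x => (x.1.1, Function.update x.1.2 0 x.2) with hR
  have hRm : Measurable R := lightCone_measurable_resample 0
  have hpm : Measurable fun z : PhaseSpace (N + 1) => z.2 0 := (measurable_pi_apply 0).comp measurable_snd
  have hvx : Measurable fun x : PhaseSpace (N + 1) × ℝ => v x.1 := hvm.comp measurable_fst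
  have hvR : Measurable fun x : PhaseSpace (N + 1) × ℝ => v (R x) := hvm.comp hRm
  have hpx : Measurable fun x : PhaseSpace (N + 1) × ℝ => x.1.2 0 := hpm.comp measurable_fst
  have hv2x : Integrable (fun x : PhaseSpace (N + 1) × ℝ => v x.1 ^ 2) (μ₀.prod ν) := hv2.comp_fst ν
  have hv4x : Integrable (fun x : PhaseSpace (N + 1) × ℝ => v x.1 ^ 4) (μ₀.prod ν) := hv4.comp_fst ν
  have hv2R : Integrable (fun x : PhaseSpace (N + 1) × ℝ => v (R x) ^ 2) (μ₀.prod ν) :=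
    lightCone_integrable_comp_resample hω hl hβ hT N (F := fun z => v z ^ 2) (hvm.pow_const 2).aestronglyMeasurable hv2
  have hv4R : Integrable (fun x : PhaseSpace (N + 1) × ℝ => v (R x) ^ 4) (μ₀.prod ν) :=
    lightCone_integrable_comp_resample hω hl hβ hT N (F := fun z => v z ^ 4) (hvm.pow_const 4).aestronglyMeasurable hv4
  have hp2x : Integrable (fun x : PhaseSpace (N + 1) × ℝ => x.1.2 0 ^ 2) (μ₀.prod ν) :=
    (lightCone_integrable_momentum_pow hω hl hβ hT 0 2).comp_fst ν
  have hp8x : Integrable (fun x : PhaseSpace (N + 1) × ℝ => x.1.2 0 ^ 8) (μ₀.prod ν) :=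
    (lightCone_integrable_momentum_pow hω hl hβ hT 0 8).comp_fst ν
  -- the propagation functional
  set D : ℝ := ∫ x, (v x.1 - v (R x)) ^ 2 ∂(μ₀.prod ν) with hD
  have hD0 : 0 ≤ D := integral_nonneg fun x => sq_nonneg _
  have hg2 : Integrable (fun x : PhaseSpace (N + 1) × ℝ => (v x.1 - v (R x)) ^ 2) (μ₀.prod ν) := by
    refine ((hv2x.add hv2R).const_mul 2).mono' ((hvx.sub hvR).pow_const 2).aestronglyMeasurable
      (Eventually.of_forall fun x => ?_)
    rw [Real.norm_eq_abs, abs_of_nonneg (sq_nonneg _)]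
    change (v x.1 - v (R x)) ^ 2 ≤ 2 * (v x.1 ^ 2 + v (R x) ^ 2)
    nlinarith [sq_nonneg (v x.1 + v (R x))]
  constructor
  · -- `r_N² ≤ T D`
    have hcs := lightCone_integral_mul_sq_le hpx.aestronglyMeasurable ((hvx.sub hvR).aestronglyMeasurable) hp2x hg2
    have hT2 : ∫ x : PhaseSpace (N + 1) × ℝ, x.1.2 0 ^ 2 ∂(μ₀.prod ν) = T := by
      rw [integral_fun_fst (fun z : PhaseSpace (N + 1) => z.2 0 ^ 2), probReal_univ, one_smul]
      exact gibbs_sq_momentum hω hl hβ hT 0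
    rw [hT2] at hcs
    exact hcs
  · -- `P_N² ≤ K² D`
    have hsplit : (fun x : PhaseSpace (N + 1) × ℝ => x.1.2 0 ^ 2 * (v x.1 ^ 2 - v (R x) ^ 2)) =
        fun x => (x.1.2 0 ^ 2 * (v x.1 + v (R x))) * (v x.1 - v (R x)) := by
      funext x; ring
    have hpt : ∀ x : PhaseSpace (N + 1) × ℝ,
        (x.1.2 0 ^ 2 * (v x.1 + v (R x))) ^ 2 ≤ 2 * x.1.2 0 ^ 8 + v x.1 ^ 4 + v (R x) ^ 4 :=
      fun x => lightCone_sq_mul_add_sq_le _ _ _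
    have hmaj : Integrable (fun x : PhaseSpace (N + 1) × ℝ => 2 * x.1.2 0 ^ 8 + v x.1 ^ 4 + v (R x) ^ 4)
        (μ₀.prod ν) := ((hp8x.const_mul 2).add hv4x).add hv4R
    have hf2 : Integrable (fun x : PhaseSpace (N + 1) × ℝ => (x.1.2 0 ^ 2 * (v x.1 + v (R x))) ^ 2) (μ₀.prod ν) := by
      refine hmaj.mono' (((hpx.pow_const 2).mul (hvx.add hvR)).pow_const 2).aestronglyMeasurable
        (Eventually.of_forall fun x => ?_)
      rw [Real.norm_eq_abs, abs_of_nonneg (sq_nonneg _)]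
      exact hpt x
    have hcs := lightCone_integral_mul_sq_le (((hpx.pow_const 2).mul (hvx.add hvR)).aestronglyMeasurable)
      ((hvx.sub hvR).aestronglyMeasurable) hf2 hg2
    have hK2 : ∫ x, (x.1.2 0 ^ 2 * (v x.1 + v (R x))) ^ 2 ∂(μ₀.prod ν) ≤ 2 * M8 + 2 * M4 := by
      have hle : ∫ x, (x.1.2 0 ^ 2 * (v x.1 + v (R x))) ^ 2 ∂(μ₀.prod ν) ≤
          ∫ x, (2 * x.1.2 0 ^ 8 + v x.1 ^ 4 + v (R x) ^ 4) ∂(μ₀.prod ν) := integral_mono hf2 hmaj hpt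
      have h8 : ∫ x : PhaseSpace (N + 1) × ℝ, x.1.2 0 ^ 8 ∂(μ₀.prod ν) = M8 := by
        rw [integral_fun_fst (fun z : PhaseSpace (N + 1) => z.2 0 ^ 8), probReal_univ, one_smul]
        exact lightCone_integral_momentum_pow hω hl hβ hT 0 8
      have h4a : ∫ x : PhaseSpace (N + 1) × ℝ, v x.1 ^ 4 ∂(μ₀.prod ν) ≤ M4 := by
        rw [integral_fun_fst (fun z : PhaseSpace (N + 1) => v z ^ 4), probReal_univ, one_smul]
        exact hv4le
      have h4b : ∫ x : PhaseSpace (N + 1) × ℝ, v (R x) ^ 4 ∂(μ₀.prod ν) ≤ M4 := by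
        have : ∫ x : PhaseSpace (N + 1) × ℝ, v (R x) ^ 4 ∂(μ₀.prod ν) = ∫ z, v z ^ 4 ∂μ₀ :=
          lightCone_integral_comp_resample hω hl hβ hT N (F := fun z => v z ^ 4) (hvm.pow_const 4)
        rw [this]; exact hv4le
      have h2 : Integrable (fun x : PhaseSpace (N + 1) × ℝ => 2 * x.1.2 0 ^ 8 + v x.1 ^ 4) (μ₀.prod ν) :=
        (hp8x.const_mul 2).add hv4x
      have h3 : Integrable (fun x : PhaseSpace (N + 1) × ℝ => 2 * x.1.2 0 ^ 8) (μ₀.prod ν) := hp8x.const_mul 2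
      rw [integral_add h2 hv4R, integral_add h3 hv4x, integral_const_mul] at hle
      linarith
    rw [hsplit]
    calc (∫ x, x.1.2 0 ^ 2 * (v x.1 + v (R x)) * (v x.1 - v (R x)) ∂(μ₀.prod ν)) ^ 2
        ≤ (∫ x, (x.1.2 0 ^ 2 * (v x.1 + v (R x))) ^ 2 ∂(μ₀.prod ν)) * D := hcs
      _ ≤ (2 * M8 + 2 * M4) * D := mul_le_mul_of_nonneg_right hK2 hD0

end Reduction

/-- **Registered helper `lightCone_reduction`.** For the pinned chain (`ω₂ > 0`, `lam, β, γ ≥ 0`) at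
`T > 0` there is `K = K(T) ≥ 0` such that for EVERY `N` and `t`, with the propagation functional
`D_N(t) = ∫ (v_t(z) - v_t(z̃))² d(μ₀ ⊗ N(0,T))` (`z̃` = `z` with `p₀` resampled, `v_t = fcast`):
`r_N(t)² ≤ T · D_N(t)` and `|P_N(t)| ≤ K √(D_N(t))`. The light-cone stub is thus EXACTLY the
finite-speed-of-propagation estimate `N^{1+η} sup_{t ≤ N^η} D_N(t) → 0`. -/
theorem lightCone_reduction : ∀ ω₂ lam β γ : ℝ, 0 < ω₂ → 0 ≤ lam → 0 ≤ β → 0 ≤ γ → ∀ T : ℝ, 0 < T →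
    ∃ K : ℝ, 0 ≤ K ∧ ∀ (N : ℕ) (t : ℝ),
      (pairCorr ω₂ lam β γ T N t) ^ 2 ≤ T * ∫ x : PhaseSpace (N + 1) × ℝ, (fcast ω₂ lam β γ T N t x.1 -
          fcast ω₂ lam β γ T N t ((x.1.1, Function.update x.1.2 0 x.2) : PhaseSpace (N + 1))) ^ 2
          ∂(((pinnedChain ω₂ lam β γ).gibbsMeasure (N + 1) T).prod (ProbabilityTheory.gaussianReal 0 T.toNNReal)) ∧
      |commonPast ω₂ lam β γ T N t| ≤ K * Real.sqrt (∫ x : PhaseSpace (N + 1) × ℝ, (fcast ω₂ lam β γ T N t x.1 -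
          fcast ω₂ lam β γ T N t ((x.1.1, Function.update x.1.2 0 x.2) : PhaseSpace (N + 1))) ^ 2
          ∂(((pinnedChain ω₂ lam β γ).gibbsMeasure (N + 1) T).prod (ProbabilityTheory.gaussianReal 0 T.toNNReal))) := by
  intro ω₂ lam β γ hω hl hβ hγ T hT
  have hK0 : 0 ≤ 2 * ∫ s, s ^ 8 ∂(gaussianReal 0 T.toNNReal) + 2 * ∫ s, s ^ 4 ∂(gaussianReal 0 T.toNNReal) := by
    have h8 : 0 ≤ ∫ s, s ^ 8 ∂(gaussianReal 0 T.toNNReal) := integral_nonneg fun s => by positivity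
    have h4 : 0 ≤ ∫ s, s ^ 4 ∂(gaussianReal 0 T.toNNReal) := integral_nonneg fun s => by positivity
    linarith
  refine ⟨Real.sqrt (2 * ∫ s, s ^ 8 ∂(gaussianReal 0 T.toNNReal) + 2 * ∫ s, s ^ 4 ∂(gaussianReal 0 T.toNNReal)),
    Real.sqrt_nonneg _, fun N t => ?_⟩
  obtain ⟨hvm, hv2, hv4, -, hv4le⟩ := lightCone_fcast_moments ω₂ lam β γ hω hl hβ hγ T hT N t
  obtain ⟨h1, h2⟩ := lightCone_reduction_aux hω hl hβ hT N hvm hv2 hv4 hv4le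
  refine ⟨?_, ?_⟩
  · rw [lightCone_pairCorr_eq hω hl hβ hT N hγ t]
    exact h1
  · rw [lightCone_commonPast_eq hω hl hβ hT N hγ t]
    refine lightCone_abs_le_of_sq_le (Real.sqrt_nonneg _) ?_
    rw [Real.sq_sqrt hK0]
    exact h2

end Summit.AtomisticToContinuum.FouriersLaw.Theorems.PhononMeanFreePath

end
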